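import Mathlib
import Literature.Topology.FourManifolds.SPC4Wave0
import Literature.AlgebraicTopology.SingularHomology.SingularChains
import Literature.Geometry.Kaehler.ManifoldFormsPullback
import Literature.Geometry.Symplectic.SteinDomain
import Literature.Geometry.Symplectic.SteinLiouvilleField
import Literature.Topology.FourManifolds.RegularLevelSplitting
import HarnessLib

/-!
# McleanDivisorComplementConvexFour

Topic `Literature/Geometry/Symplectic`. Named literature fact(s) relocated by the gate from `Summits/SmoothPoincare4/SmoothPoincare4/Theorems/SymplecticOrigamiNoGenusTwoDoorStubLiouvillePackaging.lean`
(accept-time relocation of `[cite]`d propositions written inline in a Summits proposal; human ruling 2026-08-15).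
Sources: DiogoLisi2019, Kosinski1993, McDuffSalamon2017, Mclean2012, MilnorMorseTheory1963.

* `Literature.Geometry.Symplectic.isConnected_compl_range_of_isSmoothEmbedding`
* `Literature.Geometry.Symplectic.isPreconnected_sublevel_of_forall_mfderiv_ne_zero`
* `Literature.Geometry.Symplectic.mclean_divisorComplement_convex_four`
-/

namespace Literature.Geometry.Symplectic

open scoped _root_.Manifold _root_.ContDiff _root_.Topology _root_.ContinuousMap
open _root_.Set _root_.Function _root_.TopologicalSpace
open Literature.Geometry.Kaehler (MForm IsSmoothForm IsClosedForm mextDeriv)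
open Literature.AlgebraicTopology.SingularHomology
open Literature.Topology.FourManifolds (singularHomologyZ)
open Literature.Topology.FourManifolds (IsRegularLevel RegularSublevel HalfSliceAtlas)
open Literature.Topology.FourManifolds (isRegularLevel_of_not_isMCriticalPt)
open Literature.Topology.FourManifolds (sublevelAtlas'_datum_apply_zero_of_eq)
open Literature.Geometry.Symplectic (alt2Flat alt2Flat_apply alt1ToCLM alt1ToCLM_apply)
open Literature.Geometry.Symplectic (exists_continuousLinearEquiv_eq_of_injective)

/-- **The exact complement of a symplectic surface is a finite-type convex symplectic manifold**
(McLean, GAFA 2012, Lemma 5.17: "Suppose that `S₁, …, S_k` are orthogonal positively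
intersecting [codimension `2` symplectic] submanifolds of a compact symplectic manifold
`(M, ω_M)` and suppose that there is a `1`-form `θ` [on `M ∖ ∪ Sᵢ`] such that `dθ = ω_M` [and]
the wrapping of `θ` around `Sᵢ` for each `i` is negative.  Then there exists a function `f`
defined on `M ∖ ∪ᵢ Sᵢ` such that `(M ∖ ∪ᵢ Sᵢ, θ + df)` has the structure of a finite type convex
symplectic manifold", i.e. (ibid. §4.1, §2.1) there are an exhausting function `f_M` and `C`
such that `(f_M⁻¹(-∞, c], θ + df)` is a Liouville domain — the `ω`-dual `X` of `θ + df` is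
transverse to `f_M⁻¹(c)` pointing outwards, `df_M(X) > 0` — for all `c ≥ C`; Diogo–Lisi,
J. Topol. 2019, Lemma 2.2, for one smooth divisor Poincaré dual to `K[ω]`, `K > 0`, via the
symplectic neighbourhood theorem, McDuff–Salamon Thm. 3.4.10).  Here `k = 1` in real dimension
`4`, in the tree's `MForm` vocabulary: for a closed connected symplectic `(N, s)`, a smoothly embedded compact connected `s`-symplectic
surface `B = b(S)` and `U = N ∖ B` on which `s` is exact, there are a smooth `1`-form `λ` on
`U` (an open submanifold) with `dλ = s|_U`, a smooth `g : U → ℝ` with compact sublevel sets, and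
`C` such that `dg_x(X) > 0` whenever `g x ≥ C` and `X` is the Liouville vector of `λ` at `x`
(`dλ_x(X, ·) = λ_x`).  (McLean's wrapping hypothesis is automatic here: exactness of `s` on `U`
gives `[s] = a·PD[B]` by the Thom–Gysin sequence, `a > 0` and `B·B > 0` since
`∫_B s, ∫_N s ∧ s > 0`, and Stokes on a push-off of `B` computes the wrapping number of any
primitive as `-a/2π < 0`.)
[cite: Mclean2012, Lemma 5.17 with §4.1] [cite: DiogoLisi2019, §2.1, Lemma 2.2]
[cite: McDuffSalamon2017, Thm. 3.4.10] [topic Geometry/Symplectic] -/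
def mclean_divisorComplement_convex_four : Prop :=
  ∀ (N : Type) [TopologicalSpace N] [T2Space N] [SecondCountableTopology N] [CompactSpace N]
    [ConnectedSpace N] [ChartedSpace (EuclideanSpace ℝ (Fin 4)) N] [IsManifold (𝓡 4) ∞ N]
    (s : MForm (𝓡 4) N ℝ 2)
    (S : Type) [TopologicalSpace S] [T2Space S] [CompactSpace S] [ConnectedSpace S]
    [ChartedSpace (EuclideanSpace ℝ (Fin 2)) S] [IsManifold (𝓡 2) ∞ S] (b : S → N)
    (U : TopologicalSpace.Opens N),
    IsSmoothForm s → IsClosedForm s →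
    (∀ x (v : TangentSpace (𝓡 4) x), v ≠ 0 → ∃ w, s x ![v, w] ≠ 0) →
    Manifold.IsSmoothEmbedding (𝓡 2) (𝓡 4) ∞ b →
    (∀ y (v : TangentSpace (𝓡 2) y), v ≠ 0 → ∃ w : TangentSpace (𝓡 2) y,
      s (b y) ![mfderiv (𝓡 2) (𝓡 4) b y v, mfderiv (𝓡 2) (𝓡 4) b y w] ≠ 0) →
    (U : Set N) = (Set.range b)ᶜ →
    (∃ θ : MForm (𝓡 4) U ℝ 1, IsSmoothForm θ ∧
      mextDeriv θ = s.pullback (𝓡 4) (Subtype.val : U → N)) →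
    ∃ (lam : MForm (𝓡 4) U ℝ 1) (g : U → ℝ) (C : ℝ),
      IsSmoothForm lam ∧ mextDeriv lam = s.pullback (𝓡 4) (Subtype.val : U → N) ∧
      ContMDiff (𝓡 4) 𝓘(ℝ, ℝ) ∞ g ∧ (∀ c : ℝ, IsCompact (g ⁻¹' Set.Iic c)) ∧
      ∀ x : U, C ≤ g x → ∀ v : TangentSpace (𝓡 4) x,
        (∀ w : TangentSpace (𝓡 4) x, mextDeriv lam x ![v, w] = lam x ![w]) →
        (0 : ℝ) < mfderiv (𝓡 4) 𝓘(ℝ, ℝ) g x v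

/-- **The complement of a compact submanifold of codimension at least two is connected**
(Kosinski, *Differential Manifolds* (1993), X.1, proof of Prop. (1.1): for a closed submanifold
`S ⊂ M` of codimension `c`, `Hᵢ(M ∖ S) → Hᵢ(M)` is an isomorphism for `i < c - 1`; with `i = 0`,
`c ≥ 2`, and `M ∖ S ≠ ∅` by invariance of dimension / Sard).  Typed for the image of a `C^∞`
embedding (Mathlib's `Manifold.IsSmoothEmbedding`) of a compact `m`-manifold into a connected
`p`-manifold without boundary, `m + 2 ≤ p`: the complement of the image is connected (in
particular nonempty). [cite: Kosinski1993, X.1, Prop. 1.1] [topic Geometry/Manifold] -/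
def isConnected_compl_range_of_isSmoothEmbedding : Prop :=
  ∀ (m p : ℕ) (N : Type) [TopologicalSpace N] [T2Space N] [SecondCountableTopology N]
    [ConnectedSpace N] [ChartedSpace (EuclideanSpace ℝ (Fin p)) N] [IsManifold (𝓡 p) ∞ N]
    (S : Type) [TopologicalSpace S] [CompactSpace S] [ChartedSpace (EuclideanSpace ℝ (Fin m)) S]
    [IsManifold (𝓡 m) ∞ S] (b : S → N),
    m + 2 ≤ p → Manifold.IsSmoothEmbedding (𝓡 m) (𝓡 p) ∞ b → IsConnected (Set.range b)ᶜ

/-- **High sublevel sets of an exhausting function without high critical points are connected**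
(Milnor, *Morse theory* (1963), Thm. 3.1: if `f⁻¹[a, b]` is compact and contains no critical
point, `Mᵃ` is a deformation retract of `Mᵇ`, "so that the inclusion map `Mᵃ → Mᵇ` is a
homotopy equivalence"; on a connected `M = ⋃_b Mᵇ` exhausted by compact sublevel sets this makes
every `Mᶜ`, `c ≥ C`, connected — it is the image of `M` under the retraction along the gradient
flow; cf. Hirsch, *Differential Topology* (1976), Ch. 6 §2, Thm. 2.2).  Typed: `M` a connected
`C^∞` `n`-manifold without boundary, `g : M → ℝ` smooth with compact sublevel sets and
`dg_x ≠ 0` whenever `g x ≥ C`; then `{g ≤ c}` is preconnected for every `c ≥ C`.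
[cite: MilnorMorseTheory1963, Thm. 3.1] [topic Geometry/Manifold] -/
def isPreconnected_sublevel_of_forall_mfderiv_ne_zero : Prop :=
  ∀ (n : ℕ) (M : Type) [TopologicalSpace M] [T2Space M] [SecondCountableTopology M]
    [ConnectedSpace M] [ChartedSpace (EuclideanSpace ℝ (Fin n)) M] [IsManifold (𝓡 n) ∞ M]
    (g : M → ℝ) (C : ℝ),
    ContMDiff (𝓡 n) 𝓘(ℝ, ℝ) ∞ g → (∀ c : ℝ, IsCompact (g ⁻¹' Set.Iic c)) →
    (∀ x, C ≤ g x → mfderiv (𝓡 n) 𝓘(ℝ, ℝ) g x ≠ 0) →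
    ∀ c : ℝ, C ≤ c → IsPreconnected (g ⁻¹' Set.Iic c)

/-! ### Pointwise linear algebra: the Liouville vector -/

end Literature.Geometry.Symplectic
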